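import Summits.QuantumFields.YangMills.Theorems.UnitScaleTiltProp7OneFormKatoForm
import Summits.QuantumFields.YangMills.Theorems.UnitScaleTiltProp7MassiveSolutionGradientSup
import Summits.QuantumFields.YangMills.Theorems.UnitScaleTiltProp7RieszTauFrobNormT3
import HarnessLib

/-!
# Route `UnitScaleTilt`, crux K1 «MinimiserStabilityRegPr» (stmt-QuantumFields-19200), EX one-form storey (rows `norm_G`, `norm_H₁`∕`norm_Hπ`'s gradient halves) — **(OF-GRAD): THE
# ONE-FORM GRADIENT SUP = T1 ON BONDS.**  For `Δ_a(U₀)(toL2 X) = toL2 Y` at a printed-regular background, EVERY covariant derivative of EVERY component of `X` is bounded in sup by the sups of `X`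
# and of the displayed one-form remainder: `‖D^η_{U₀,μ} X_ν‖_∞ ≤ 2·(C_g·(M_u·c(ε₀) + M_q) + 2√2·48ε₀·M_u)` — CARD-19200-V3-g26 FINAL §3′ «covariant-gradient sup (one-form T1 analogue, NOT started)».

Cell `ym3-torus` (HUMAN RULING D-0037; rung R3 = SU(2) YM₃ on T³ — NOT d = 4, NOT infinite volume, NOT a mass gap, NOT Clay).  Width seat `ym3-torus-px5` (gen 13).
THEOREMS ONLY (0 `def`, 0 `sorry`, default heartbeats); `--supports stmt-QuantumFields-19200 --as helper`; count-neutral.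

WHY ∕ HOW.  A composition of two landed bricks, no new analysis.  (i) px5 g12's O1 ✓p764247 `Prop7OneFormKatoForm.covLapSite_toL2S_formComp_eq`: for `Δ_a(toL2 X) = toL2 Y` and every
direction `ν`, the ν-COMPONENT `u_ν := toL2S (formComp X ν)` solves the SITE covariant Poisson equation `Δ^η_{U₀} u_ν + q_ν = 0` with the displayed remainder `q_ν := toL2S(R_ν) − toL2S(Y_ν)`,
`R_ν = η⁻²(Δ′₁ − 𝒦)X` (local) `+ (Δx − Δ^η)X` (slot) `− D(1 − R_S)D*X + Q_k†(a•Q_k X)` ([Balaban1985Variational] (134)–(135)); (ii) px19 g13's T1-core ✓p765411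
`Prop7MassiveSolutionGradientSup.norm_equiv_DL2_le_of_sup` bounds `‖D_{U₀} u_ν‖_∞` from the global sups of `u_ν`, `q_ν` under `RegPr` + the no-wrap room + the absorption margin.  (iii) The
dictionary ✓`Prop7LandauDict.DL2_toL2S_eq_covDerivFwdT` reads `D_{U₀}(toL2S X_ν)` at the bond `⟨x, μ⟩` as the route's covariant gradient component `covGradT η (bgUnits U₀) X μ ν x`
([Balaban1985Variational] (19)).
WHAT IS PROVED (ns `Summit.QuantumFields.YangMills.Theorems.Prop7OneFormGradientSup`; any slot `Δx` — the slot term is a letter, `0` at `DeltaEtaSlot`).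
* §1 `covLapSite_formComp_add_eq` (the equation shape `Δ u_ν + q_ν = D* 0`) · ★★★ `norm_equiv_DL2_formComp_le_of_sup` — T1 ON BONDS from the two global sup letters `hMu` (components of `X`), `hMq` (the remainder `q_ν`).
* §2 `norm_equiv_toL2S_formComp_le` · `norm_equiv_remainder_le_of_letters` (`M_q ≤ √2·(32ε₀·s + M_X + M_D + M_Q + M_Y)` from O1 ✓`norm_local_remainder_le_of_regPr` and the (X)∕(D)∕(Q)∕(Y) bond letters) ·
  ★★★ `norm_equiv_DL2_formComp_le_of_letters` — T1 on bonds displayed ONLY by `RegPr`, `‖X b‖ ≤ s`, `‖Y b‖ ≤ M_Y`, the three O2-class bond letters (X)(D)(Q), `hroom`, `hsmall`.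
* §3 ★★ `norm_covGradT_le_of_letters` — the same bound for `‖covGradT (eta F n K) (bgUnits F K U₀) X μ ν x‖` (operator norm ≤ Frobenius, ✓`norm_frobEquiv_le`): the `∇^η_{U₀}`-half of print's
  `|·|₍₁₎` norm of `𝔊f` ((115)) from VALUE-class letters.
HYP-SAT (★★OWNER RULING №42): `RegPr` + `0 < ε₀ ≤ 1` (EX class); `hXY` = the one-form equation (for `X := toL2⁻¹(G_T f)` it is ✓`laplaceA_GT`); the sup letters are data of `X`∕`Y` and the three O2∕E2E
letters ((X) `0` at `DeltaEtaSlot`; (D) ⟸ the `h349` member row ✓p765417-fed; (Q) ⟸ px21's `hk_Q` ∕ (P-Q†) ✓p764941 summed); `hroom` = CHAIR WORD №1 class (cover road for small members as for T1);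
`hsmall` = smallness of `ε₀` vs the universal `C_g`; conclusions non-vacuous; no `Prop` placeholder.
HONEST SCOPE.  Composition; nothing of T1-core, O1, the VALUE sup of `G_T` (O4∕E2E), `norm_G`'s 𝔓-algebra, the nine∕eight EX rows, `hThm2S`, EX or the crux is proved here; the Yang–Mills mass gap is NOT proved.

References: T. Bałaban, CMP **102** (1985) 277–309 [Balaban1985Variational] ((19) p.281, (110)–(117) pp.294–295, (134)–(135) p.298); CMP **99** (1985) 389–434
[Balaban1985BackgroundPropagators] (Lemma 3.2 (3.45)–(3.48) pp.398–399, Thm 3.1 (3.42) p.397); CMP **96** (1984) 223–250 [Balaban1984PropagatorsII] (Lemma 2.1 pp.7–8).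
-/

set_option autoImplicit false

noncomputable section

open scoped BigOperators Matrix.Norms.L2Operator InnerProductSpace ComplexConjugate

namespace Summit.QuantumFields.YangMills.Theorems.Prop7OneFormGradientSup

open Literature.MathematicalPhysics.QuantumFieldTheory.Balaban1983to89
open Literature.MathematicalPhysics.QuantumFieldTheory.Balaban1983to89.T3ContinuumYM3Torus
open Literature.MathematicalPhysics.QuantumFieldTheory.Balaban1983to89.T3PrintedRegularMinimiser (RegPr)
open T3SectALandauChart (formComp covGradT bgUnits covDerivFwdT eta eta_pos)
open B4Sect5Torus (TSite)
open B9SectCLatticeCarrier (Bond)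
open B9TorusCalculus (torusT)
open B9Eq310Hermitian (deltaPrimeOp)
open B11Eq135Weitzenbock (curvOp)
open B9Eq311L2Pairing (WL2)
open B11Eq103H1Complex (SiteL2K BondL2K)
open Summit.QuantumFields.YangMills.Theorems.Prop7SectET3Transport (periodsT3 siteEquiv bondEquiv)
open Summit.QuantumFields.YangMills.Theorems.Prop7SectET3HilbertLetters (W₂ frobEquiv toL2 toL2S DL2 DstarL2 covLapSite toL2S_apply toL2_symm_apply)
open Summit.QuantumFields.YangMills.Theorems.Prop7SectET3WilsonHessian (DeltaEta)
open Summit.QuantumFields.YangMills.Theorems.Prop7SectET3GaugeProjector (RS)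
open Summit.QuantumFields.YangMills.Theorems.Prop7SectET3CurvedPropagators (Qk laplaceA)
open Summit.QuantumFields.YangMills.Theorems.Prop7RieszTauFrobNorm (norm_frobEquiv_le norm_frobEquiv_symm_le)
open Summit.QuantumFields.YangMills.Theorems.Prop7LandauDict (DL2_toL2S_eq_covDerivFwdT)
open Summit.QuantumFields.YangMills.Theorems.Prop7OneFormKatoForm (covLapSite_toL2S_formComp_eq norm_local_remainder_le_of_regPr)
open Summit.QuantumFields.YangMills.Theorems.Prop7MassiveSolutionGradientSup (norm_equiv_DL2_le_of_sup)
open Summit.QuantumFields.YangMills.Theorems.Prop7CurvedMemberLocalGradient (exists_curved_localGradient)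
open Summit.QuantumFields.YangMills.Theorems.AxialGaugeChartGlue (norm_bgOfCfg_axialT_sub_le)

variable (F : T3Family) {n K : ℕ} (h : n ≤ K) (c₀ cB : ℝ) [Fact (0 < c₀)] [Fact (0 < cB)] (a : ℝ)
  (Δx : GaugeField (F.P K) 0 (Matrix.specialUnitaryGroup (Fin 2) ℂ) → (BondL2K ℂ 3 (periodsT3 F K) c₀ W₂ →ₗ[ℂ] BondL2K ℂ 3 (periodsT3 F K) c₀ W₂))
  (U₀ : GaugeField (F.P K) 0 (Matrix.specialUnitaryGroup (Fin 2) ℂ))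
  {ε₀ : ℝ} (hε₀ : 0 < ε₀) (hε1 : ε₀ ≤ 1) (hreg : RegPr F n K ε₀ U₀)

/-! ## §1 T1 on bonds from the two global sup letters -/

/-- The ν-component equation in T1-core's shape: `Δ^η_{U₀}(toL2S X_ν) + (toL2S R_ν − toL2S Y_ν) = D*_{U₀} 0` (O1 ✓`covLapSite_toL2S_formComp_eq` rearranged).
[cite: Balaban1985Variational, (134)–(135) p.298] -/
theorem covLapSite_formComp_add_eq (X Y : PBond (F.P K) 0 → Matrix (Fin 2) (Fin 2) ℂ)
    (hXY : laplaceA F n K h c₀ cB a Δx U₀ (toL2 F K c₀ X) = toL2 F K c₀ Y) (ν : Fin (F.P K).d) :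
    covLapSite F n K c₀ U₀ (toL2S F K c₀ (formComp X ν)) + (toL2S F K c₀ (fun x : Site (F.P K) 0 => (eta F n K)⁻¹ • (eta F n K)⁻¹ • (deltaPrimeOp (torusT (F.P K) 0) (fun μ x => bgUnits F K U₀ ⟨x, μ⟩) 1 (formComp X) ν x - curvOp (torusT (F.P K) 0) (fun μ x => bgUnits F K U₀ ⟨x, μ⟩) (formComp X) ν x) + (toL2 F K c₀).symm ((Δx U₀ - (DeltaEta F n K c₀ U₀ : BondL2K ℂ 3 (periodsT3 F K) c₀ W₂ →ₗ[ℂ] BondL2K ℂ 3 (periodsT3 F K) c₀ W₂)) (toL2 F K c₀ X)) ⟨x, ν⟩ - (toL2 F K c₀).symm (DL2 F n K c₀ U₀ (DstarL2 F n K c₀ U₀ (toL2 F K c₀ X) - RS F n K h c₀ cB U₀ (DstarL2 F n K c₀ U₀ (toL2 F K c₀ X)))) ⟨x, ν⟩ + (toL2 F K c₀).symm (LinearMap.adjoint (Qk F n K h c₀ cB U₀) (((a : ℝ) : ℂ) • Qk F n K h c₀ cB U₀ (toL2 F K c₀ X))) ⟨x, ν⟩) - toL2S F K c₀ (formComp Y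 ν)) = DstarL2 F n K c₀ U₀ 0 := by
  rw [map_zero, covLapSite_toL2S_formComp_eq F h c₀ cB a Δx U₀ X Y hXY ν]
  abel

include hε₀ hε1 hreg in
/-- ★★★ **T1 ON BONDS FROM THE TWO GLOBAL SUP LETTERS**: for `Δ_a(U₀)(toL2 X) = toL2 Y` with `‖(toL2S X_ν)(x)‖ ≤ M_u` and `‖q_ν(x)‖ ≤ M_q` for every component `ν` and lit-site `x`
(`q_ν` = O1's displayed remainder minus the source component), under `RegPr`, the room and the margin:
`‖(D_{U₀}(toL2S X_ν))(p)‖ ≤ 2·(C_g·(M_u·c(ε₀) + M_q) + 2√2·48ε₀·M_u)` at EVERY bond `p` and direction `ν` — px19's ✓`norm_equiv_DL2_le_of_sup` per component.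
[cite: Balaban1985Variational, (19) p.281, (134)–(135) p.298; Balaban1985BackgroundPropagators, Lemma 3.2 (3.45)–(3.48) pp.398–399] -/
theorem norm_equiv_DL2_formComp_le_of_sup (X Y : PBond (F.P K) 0 → Matrix (Fin 2) (Fin 2) ℂ)
    (hXY : laplaceA F n K h c₀ cB a Δx U₀ (toL2 F K c₀ X) = toL2 F K c₀ Y) {Mu Mq : ℝ} (hMu0 : 0 ≤ Mu) (hMq0 : 0 ≤ Mq)
    (hMu : ∀ (ν : Fin (F.P K).d) (x : TSite 3 (periodsT3 F K)), ‖WL2.equiv ℂ (fun _ : TSite 3 (periodsT3 F K) => c₀) W₂ (toL2S F K c₀ (formComp X ν)) x‖ ≤ Mu)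
    (hMq : ∀ (ν : Fin (F.P K).d) (x : TSite 3 (periodsT3 F K)), ‖WL2.equiv ℂ (fun _ : TSite 3 (periodsT3 F K) => c₀) W₂ (toL2S F K c₀ (fun x : Site (F.P K) 0 => (eta F n K)⁻¹ • (eta F n K)⁻¹ • (deltaPrimeOp (torusT (F.P K) 0) (fun μ x => bgUnits F K U₀ ⟨x, μ⟩) 1 (formComp X) ν x - curvOp (torusT (F.P K) 0) (fun μ x => bgUnits F K U₀ ⟨x, μ⟩) (formComp X) ν x) + (toL2 F K c₀).symm ((Δx U₀ - (DeltaEta F n K c₀ U₀ : BondL2K ℂ 3 (periodsT3 F K) c₀ W₂ →ₗ[ℂ] BondL2K ℂ 3 (periodsT3 F K) c₀ W₂)) (toL2 F K c₀ X)) ⟨x, ν⟩ - (toL2 F K c₀).symm (DL2 F n K c₀ U₀ (DstarL2 F n K c₀ U₀ (toL2 F K c₀ X) - RS F n K h c₀ cB U₀ (DstarL2 F n K c₀ U₀ (toL2 F K c₀ X)))) ⟨x, ν⟩ + (toL2 F K c₀).symm (LinearMap.adjoint (Qk F n K h c₀ cB U₀) (((a : ℝ) : ℂ) • Qk F n K h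 c₀ cB U₀ (toL2 F K c₀ X))) ⟨x, ν⟩) - toL2S F K c₀ (formComp Y ν)) x‖ ≤ Mq)
    (hroom : 2 * (12 * F.L ^ (K - n) + 5) ≤ (F.P K).sitesPerDir 0)
    (hsmall : exists_curved_localGradient.choose * ((48 * ε₀) * (6 * Real.sqrt 2 * Real.sqrt 10 + 6 * Real.sqrt 2)) ≤ 1 / 2)
    (ν : Fin (F.P K).d) (p : Bond 3 (periodsT3 F K)) :
    ‖WL2.equiv ℂ (fun _ : Bond 3 (periodsT3 F K) => c₀) W₂ (DL2 F n K c₀ U₀ (toL2S F K c₀ (formComp X ν))) p‖ ≤ 2 * (exists_curved_localGradient.choose * (Mu * (2 + 2 * Real.sqrt 2 * (4 * ε₀ * (3 + 2457 * norm_bgOfCfg_axialT_sub_le.choose)) + (24 * Real.sqrt 10 + 48) * (48 * ε₀) ^ 2) + Mq) + 2 * Real.sqrt 2 * (48 * ε₀) * Mu) :=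
  norm_equiv_DL2_le_of_sup F n K hε₀ hε1 U₀ hreg c₀ _ _ (covLapSite_formComp_add_eq F h c₀ cB a Δx U₀ X Y hXY ν) hMu0 hMq0 (hMu ν) (hMq ν) hroom hsmall p

/-! ## §2 The letters: the component sup and the remainder split -/

omit [Fact (0 < c₀)] [Fact (0 < cB)] in
/-- `‖(toL2S X_ν)(x)‖ ≤ √2·s` from `‖X b‖ ≤ s` (Frobenius vs operator norm, ✓`norm_frobEquiv_symm_le`). [cite: Balaban1985BackgroundPropagators, (3.11) p.392] -/
theorem norm_equiv_toL2S_formComp_le (X : PBond (F.P K) 0 → Matrix (Fin 2) (Fin 2) ℂ) {s : ℝ} (hX : ∀ b, ‖X b‖ ≤ s)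
    (ν : Fin (F.P K).d) (x : TSite 3 (periodsT3 F K)) :
    ‖WL2.equiv ℂ (fun _ : TSite 3 (periodsT3 F K) => c₀) W₂ (toL2S F K c₀ (formComp X ν)) x‖ ≤ Real.sqrt 2 * s := by
  rw [toL2S_apply]
  refine (norm_frobEquiv_symm_le _).trans ?_
  exact mul_le_mul_of_nonneg_left (hX _) (Real.sqrt_nonneg _)

include hreg in
/-- **THE REMAINDER LETTER `M_q` FROM THE BOND LETTERS**: with `‖X b‖ ≤ s`, `‖Y b‖ ≤ M_Y` and the three O2-class bond rows `‖((Δx − Δ^η)X)(b)‖ ≤ M_X`, `‖(D(1 − R_S)D*X)(b)‖ ≤ M_D`,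
`‖(Q_k†(a•Q_kX))(b)‖ ≤ M_Q` (route matrices, operator norm), every component of `q_ν` obeys `‖q_ν(x)‖ ≤ √2·(32ε₀·s + M_X + M_D + M_Q + M_Y)` (O1 ✓`norm_local_remainder_le_of_regPr` for the
local term). [cite: Balaban1985Variational, (134)–(135) p.298; Balaban1985BackgroundPropagators, (3.102) p.414] -/
theorem norm_equiv_remainder_le_of_letters (X Y : PBond (F.P K) 0 → Matrix (Fin 2) (Fin 2) ℂ)
    {s MY MX MD MQ : ℝ} (hX : ∀ b, ‖X b‖ ≤ s) (hY : ∀ b, ‖Y b‖ ≤ MY)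
    (hXs : ∀ b : PBond (F.P K) 0, ‖(toL2 F K c₀).symm ((Δx U₀ - (DeltaEta F n K c₀ U₀ : BondL2K ℂ 3 (periodsT3 F K) c₀ W₂ →ₗ[ℂ] BondL2K ℂ 3 (periodsT3 F K) c₀ W₂)) (toL2 F K c₀ X)) b‖ ≤ MX)
    (hD : ∀ b : PBond (F.P K) 0, ‖(toL2 F K c₀).symm (DL2 F n K c₀ U₀ (DstarL2 F n K c₀ U₀ (toL2 F K c₀ X) - RS F n K h c₀ cB U₀ (DstarL2 F n K c₀ U₀ (toL2 F K c₀ X)))) b‖ ≤ MD)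
    (hQ : ∀ b : PBond (F.P K) 0, ‖(toL2 F K c₀).symm (LinearMap.adjoint (Qk F n K h c₀ cB U₀) (((a : ℝ) : ℂ) • Qk F n K h c₀ cB U₀ (toL2 F K c₀ X))) b‖ ≤ MQ)
    (ν : Fin (F.P K).d) (x : TSite 3 (periodsT3 F K)) :
    ‖WL2.equiv ℂ (fun _ : TSite 3 (periodsT3 F K) => c₀) W₂ (toL2S F K c₀ (fun x : Site (F.P K) 0 => (eta F n K)⁻¹ • (eta F n K)⁻¹ • (deltaPrimeOp (torusT (F.P K) 0) (fun μ x => bgUnits F K U₀ ⟨x, μ⟩) 1 (formComp X) ν x - curvOp (torusT (F.P K) 0) (fun μ x => bgUnits F K U₀ ⟨x, μ⟩) (formComp X) ν x) + (toL2 F K c₀).symm ((Δx U₀ - (DeltaEta F n K c₀ U₀ : BondL2K ℂ 3 (periodsT3 F K) c₀ W₂ →ₗ[ℂ] BondL2K ℂ 3 (periodsT3 F K) c₀ W₂)) (toL2 F K c₀ X)) ⟨x, ν⟩ - (toL2 F K c₀).symm (DL2 F n K c₀ U₀ (DstarL2 F n K c₀ U₀ (toL2 F K c₀ X) - RS F n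 K h c₀ cB U₀ (DstarL2 F n K c₀ U₀ (toL2 F K c₀ X)))) ⟨x, ν⟩ + (toL2 F K c₀).symm (LinearMap.adjoint (Qk F n K h c₀ cB U₀) (((a : ℝ) : ℂ) • Qk F n K h c₀ cB U₀ (toL2 F K c₀ X))) ⟨x, ν⟩) - toL2S F K c₀ (formComp Y ν)) x‖ ≤ Real.sqrt 2 * (32 * ε₀ * s + MX + MD + MQ + MY) := by
  rw [WL2.equiv_sub, Pi.sub_apply, toL2S_apply, toL2S_apply, ← map_sub]
  refine (norm_frobEquiv_symm_le _).trans (mul_le_mul_of_nonneg_left ?_ (Real.sqrt_nonneg _))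
  set x' : Site (F.P K) 0 := (siteEquiv F K).symm x with hx'
  have hL := norm_local_remainder_le_of_regPr F (n := n) (K := K) U₀ hreg hX ⟨x', ν⟩
  have h1 := hXs ⟨x', ν⟩
  have h2 := hD ⟨x', ν⟩
  have h3 := hQ ⟨x', ν⟩
  have h4 := hY ⟨x', ν⟩
  -- `‖L + S − D + Q − Y‖ ≤ ‖L‖ + ‖S‖ + ‖D‖ + ‖Q‖ + ‖Y‖`
  have e : ∀ (L S D Q Yv : Matrix (Fin 2) (Fin 2) ℂ), ‖L + S - D + Q - Yv‖ ≤ ‖L‖ + ‖S‖ + ‖D‖ + ‖Q‖ + ‖Yv‖ := by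
    intro L S D Q Yv
    calc ‖L + S - D + Q - Yv‖ ≤ ‖L + S - D + Q‖ + ‖Yv‖ := norm_sub_le _ _
      _ ≤ ‖L + S - D‖ + ‖Q‖ + ‖Yv‖ := by gcongr; exact norm_add_le _ _
      _ ≤ ‖L + S‖ + ‖D‖ + ‖Q‖ + ‖Yv‖ := by gcongr; exact norm_sub_le _ _
      _ ≤ ‖L‖ + ‖S‖ + ‖D‖ + ‖Q‖ + ‖Yv‖ := by gcongr; exact norm_add_le _ _
  refine (e _ _ _ _ _).trans ?_
  show ‖(eta F n K)⁻¹ • (eta F n K)⁻¹ • (deltaPrimeOp (torusT (F.P K) 0) (fun μ x => bgUnits F K U₀ ⟨x, μ⟩) 1 (formComp X) ν x' - curvOp (torusT (F.P K) 0) (fun μ x => bgUnits F K U₀ ⟨x, μ⟩) (formComp X) ν x')‖ + _ + _ + _ + ‖formComp Y ν x'‖ ≤ _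
  have h5 : ‖formComp Y ν x'‖ ≤ MY := h4
  linarith

include hε₀ hε1 hreg in
/-- ★★★ **T1 ON BONDS, LETTERS DISPLAYED**: for `Δ_a(U₀)(toL2 X) = toL2 Y` under `RegPr` (`0 < ε₀ ≤ 1`), with `‖X b‖ ≤ s`, `‖Y b‖ ≤ M_Y`, the three O2-class bond rows (X)(D)(Q), the room and the margin:
`‖(D_{U₀}(toL2S X_ν))(p)‖ ≤ 2·(C_g·(√2 s·c(ε₀) + √2(32ε₀ s + M_X + M_D + M_Q + M_Y)) + 2√2·48ε₀·√2 s)` at every bond and direction.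
[cite: Balaban1985Variational, (19) p.281, (134)–(135) p.298; Balaban1985BackgroundPropagators, Lemma 3.2 pp.398–399, Thm 3.1 (3.42) p.397] -/
theorem norm_equiv_DL2_formComp_le_of_letters (X Y : PBond (F.P K) 0 → Matrix (Fin 2) (Fin 2) ℂ)
    (hXY : laplaceA F n K h c₀ cB a Δx U₀ (toL2 F K c₀ X) = toL2 F K c₀ Y)
    {s MY MX MD MQ : ℝ} (hs : 0 ≤ s) (hMY : 0 ≤ MY) (hMX : 0 ≤ MX) (hMD : 0 ≤ MD) (hMQ : 0 ≤ MQ)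
    (hX : ∀ b, ‖X b‖ ≤ s) (hY : ∀ b, ‖Y b‖ ≤ MY)
    (hXs : ∀ b : PBond (F.P K) 0, ‖(toL2 F K c₀).symm ((Δx U₀ - (DeltaEta F n K c₀ U₀ : BondL2K ℂ 3 (periodsT3 F K) c₀ W₂ →ₗ[ℂ] BondL2K ℂ 3 (periodsT3 F K) c₀ W₂)) (toL2 F K c₀ X)) b‖ ≤ MX)
    (hD : ∀ b : PBond (F.P K) 0, ‖(toL2 F K c₀).symm (DL2 F n K c₀ U₀ (DstarL2 F n K c₀ U₀ (toL2 F K c₀ X) - RS F n K h c₀ cB U₀ (DstarL2 F n K c₀ U₀ (toL2 F K c₀ X)))) b‖ ≤ MD)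
    (hQ : ∀ b : PBond (F.P K) 0, ‖(toL2 F K c₀).symm (LinearMap.adjoint (Qk F n K h c₀ cB U₀) (((a : ℝ) : ℂ) • Qk F n K h c₀ cB U₀ (toL2 F K c₀ X))) b‖ ≤ MQ)
    (hroom : 2 * (12 * F.L ^ (K - n) + 5) ≤ (F.P K).sitesPerDir 0)
    (hsmall : exists_curved_localGradient.choose * ((48 * ε₀) * (6 * Real.sqrt 2 * Real.sqrt 10 + 6 * Real.sqrt 2)) ≤ 1 / 2)
    (ν : Fin (F.P K).d) (p : Bond 3 (periodsT3 F K)) :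
    ‖WL2.equiv ℂ (fun _ : Bond 3 (periodsT3 F K) => c₀) W₂ (DL2 F n K c₀ U₀ (toL2S F K c₀ (formComp X ν))) p‖ ≤ 2 * (exists_curved_localGradient.choose * ((Real.sqrt 2 * s) * (2 + 2 * Real.sqrt 2 * (4 * ε₀ * (3 + 2457 * norm_bgOfCfg_axialT_sub_le.choose)) + (24 * Real.sqrt 10 + 48) * (48 * ε₀) ^ 2) + (Real.sqrt 2 * (32 * ε₀ * s + MX + MD + MQ + MY))) + 2 * Real.sqrt 2 * (48 * ε₀) * (Real.sqrt 2 * s)) := by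
  have hMu0 : 0 ≤ Real.sqrt 2 * s := by positivity
  have hMq0 : 0 ≤ Real.sqrt 2 * (32 * ε₀ * s + MX + MD + MQ + MY) := by positivity
  exact norm_equiv_DL2_formComp_le_of_sup F h c₀ cB a Δx U₀ hε₀ hε1 hreg X Y hXY hMu0 hMq0
    (fun ν x => norm_equiv_toL2S_formComp_le F c₀ X hX ν x)
    (fun ν x => norm_equiv_remainder_le_of_letters F h c₀ cB a Δx U₀ hreg X Y hX hY hXs hD hQ ν x) hroom hsmall ν p

/-! ## §3 The same bound for the route's covariant gradient `covGradT` -/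

include hε₀ hε1 hreg in
/-- ★★ **THE COVARIANT GRADIENT OF THE ONE-FORM IN SUP** — `‖(D^η_{U₀,μ} X_ν)(x)‖ = ‖covGradT (eta F n K) (bgUnits F K U₀) X μ ν x‖ ≤` the §2 bound, for every `μ ν x` (the dictionary
✓`DL2_toL2S_eq_covDerivFwdT` + operator norm ≤ Frobenius norm ✓`norm_frobEquiv_le`): the `∇^η_{U₀}`-half of print's `|𝔊f|₍₁₎` from VALUE-class letters.
[cite: Balaban1985Variational, (19) p.281, (115)–(117) pp.294–295; Balaban1985BackgroundPropagators, Thm 3.1 (3.42) p.397] -/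
theorem norm_covGradT_le_of_letters (X Y : PBond (F.P K) 0 → Matrix (Fin 2) (Fin 2) ℂ)
    (hXY : laplaceA F n K h c₀ cB a Δx U₀ (toL2 F K c₀ X) = toL2 F K c₀ Y)
    {s MY MX MD MQ : ℝ} (hs : 0 ≤ s) (hMY : 0 ≤ MY) (hMX : 0 ≤ MX) (hMD : 0 ≤ MD) (hMQ : 0 ≤ MQ)
    (hX : ∀ b, ‖X b‖ ≤ s) (hY : ∀ b, ‖Y b‖ ≤ MY)
    (hXs : ∀ b : PBond (F.P K) 0, ‖(toL2 F K c₀).symm ((Δx U₀ - (DeltaEta F n K c₀ U₀ : BondL2K ℂ 3 (periodsT3 F K) c₀ W₂ →ₗ[ℂ] BondL2K ℂ 3 (periodsT3 F K) c₀ W₂)) (toL2 F K c₀ X)) b‖ ≤ MX)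
    (hD : ∀ b : PBond (F.P K) 0, ‖(toL2 F K c₀).symm (DL2 F n K c₀ U₀ (DstarL2 F n K c₀ U₀ (toL2 F K c₀ X) - RS F n K h c₀ cB U₀ (DstarL2 F n K c₀ U₀ (toL2 F K c₀ X)))) b‖ ≤ MD)
    (hQ : ∀ b : PBond (F.P K) 0, ‖(toL2 F K c₀).symm (LinearMap.adjoint (Qk F n K h c₀ cB U₀) (((a : ℝ) : ℂ) • Qk F n K h c₀ cB U₀ (toL2 F K c₀ X))) b‖ ≤ MQ)
    (hroom : 2 * (12 * F.L ^ (K - n) + 5) ≤ (F.P K).sitesPerDir 0)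
    (hsmall : exists_curved_localGradient.choose * ((48 * ε₀) * (6 * Real.sqrt 2 * Real.sqrt 10 + 6 * Real.sqrt 2)) ≤ 1 / 2)
    (μ ν : Fin (F.P K).d) (x : Site (F.P K) 0) :
    ‖covGradT (eta F n K) (bgUnits F K U₀) X μ ν x‖ ≤ 2 * (exists_curved_localGradient.choose * ((Real.sqrt 2 * s) * (2 + 2 * Real.sqrt 2 * (4 * ε₀ * (3 + 2457 * norm_bgOfCfg_axialT_sub_le.choose)) + (24 * Real.sqrt 10 + 48) * (48 * ε₀) ^ 2) + (Real.sqrt 2 * (32 * ε₀ * s + MX + MD + MQ + MY))) + 2 * Real.sqrt 2 * (48 * ε₀) * (Real.sqrt 2 * s)) := by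
  have hdict : covGradT (eta F n K) (bgUnits F K U₀) X μ ν x = (toL2 F K c₀).symm (DL2 F n K c₀ U₀ (toL2S F K c₀ (formComp X ν))) ⟨x, μ⟩ := by
    rw [DL2_toL2S_eq_covDerivFwdT]; rfl
  rw [hdict, toL2_symm_apply]
  exact (norm_frobEquiv_le _).trans
    (norm_equiv_DL2_formComp_le_of_letters F h c₀ cB a Δx U₀ hε₀ hε1 hreg X Y hXY hs hMY hMX hMD hMQ hX hY hXs hD hQ hroom hsmall ν _)

end Summit.QuantumFields.YangMills.Theorems.Prop7OneFormGradientSup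

end
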